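import Summits.NavierStokesRegularity.NavierStokesRegularity.Theses.QuantisedSymmetry
import Summits.NavierStokesRegularity.NavierStokesRegularity.Theorems.QuantisedSymmetryPolyhedralDssProfileExistsDominatesBlowupProfile
import Literature.Analysis.FluidPDE.ClassicalSolution
import HarnessLib

/-!
# Strategist sketch s18-g6 — crux `QuantisedSymmetry.PolyhedralDssProfileExists` (stmt-NavierStokesRegularity-1404)

Typed companions of `STRATEGY-CENSUS-s18.md` (independent census, family `s`, gen 6):

* `crux_iff` — the crux is `∃ G polyhedral, ∃ c > 1, ∃ u, IsProfile G c u` (bookkeeping only);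
* `weaker_blowupProfile` — the strictly-weaker sibling `Blowup.BlowupTypeIDssProfile` follows from the
  crux BY NAME (landed `stub_dominatesBlowupProfile`); it is itself an open ∃-crux (stmt-0155 / stmt-14193);
* `IsolatedProfileExists` — the rigid strengthening S⁺ (local uniqueness modulo the scaling phase) and
  `crux_of_isolated : S⁺ → crux`;
* `ApproxFamily` / `CompactnessBridge` — the best typed split Σ2 ("vanishing-residual family + Type-I
  compactness"), with the proved assembly `crux_of_sigma2`; the census explains why `ApproxFamily`
  is the whole crux again (no small parameter: residuals of explicit polyhedral DSS fields are O(1)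
  in the scale-invariant envelope).
Nothing here is a registered line; no stub is claimed.
-/

noncomputable section

set_option linter.dupNamespace false

namespace Summit.NavierStokesRegularity.NavierStokesRegularity.Cruxes.PolyhedralDssProfileExists.StrategistS18g6

open MeasureTheory Set
open Literature.Analysis.FluidPDE
open Summit.NavierStokesRegularity.NavierStokesRegularity.Theses

/-- Euclidean 3-space. -/
abbrev E3 := EuclideanSpace ℝ (Fin 3)

/-- Its linear isometry group (the ambient group of the crux). -/
abbrev Iso3 := EuclideanSpace ℝ (Fin 3) ≃ₗᵢ[ℝ] EuclideanSpace ℝ (Fin 3)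

/-- The polyhedral sector: finite, orientation-preserving, irreducible on `ℝ³`
(so `G ∈ {T, O, I}` as an abstract rotation group). -/
def IsPolyhedral (G : Subgroup Iso3) : Prop :=
  Finite G ∧ (∀ g ∈ G, LinearMap.det (g.toLinearEquiv : E3 →ₗ[ℝ] E3) = 1) ∧
    (∀ V : Submodule ℝ E3, (∀ g ∈ G, ∀ v ∈ V, g v ∈ V) → V = ⊥ ∨ V = ⊤)

/-- The profile clauses of the crux for a fixed sector `G`, factor `c` and field `u`. -/
def IsProfile (G : Subgroup Iso3) (c : ℝ) (u : ℝ → E3 → E3) : Prop :=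
  IsAncientMildSolution 1 u ∧ (∀ t < 0, AEStronglyMeasurable (u t) volume) ∧
    IsDiscretelySelfSimilar c u ∧ (∃ C₀ : ℝ, HasTypeIDecay C₀ u) ∧
    (∀ g ∈ G, ∀ t x, u t (g x) = g (u t x)) ∧ ¬ (∀ t < 0, u t =ᵐ[volume] 0)

/-- Bookkeeping: the crux, verbatim, is `∃ G polyhedral, ∃ c > 1, ∃ u, IsProfile G c u`. -/
theorem crux_iff :
    QuantisedSymmetry.PolyhedralDssProfileExists ↔
      ∃ G : Subgroup Iso3, IsPolyhedral G ∧ ∃ c : ℝ, 1 < c ∧ ∃ u, IsProfile G c u := by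
  unfold QuantisedSymmetry.PolyhedralDssProfileExists IsPolyhedral IsProfile
  constructor
  · rintro ⟨G, h1, h2, h3, c, hc, u, hu⟩
    exact ⟨G, ⟨h1, h2, h3⟩, c, hc, u, hu⟩
  · rintro ⟨G, ⟨h1, h2, h3⟩, c, hc, u, hu⟩
    exact ⟨G, h1, h2, h3, c, hc, u, hu⟩

/-! ## Weaker intermediate (heading "weaker intermediates" of the census) -/

/-- The sector-free Type-I DSS profile (`Blowup.BlowupTypeIDssProfile`, ex stmt-0155, shared as
stmt-14193) is implied by the crux — landed, by name. It is strictly weaker in statement and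
still an OPEN existence claim with no mechanism in print (census §1). -/
theorem weaker_blowupProfile :
    QuantisedSymmetry.PolyhedralDssProfileExists → Blowup.BlowupTypeIDssProfile :=
  Theorems.PolyhedralDssProfileExists.PolyhedralCell.stub_dominatesBlowupProfile

/-! ## Strengthen: the rigid form S⁺ (local uniqueness modulo the scaling phase) -/

/-- **S⁺ (isolated profile).** A polyhedral profile exists which is locally unique among profiles
with the same sector and factor, modulo the residual symmetry `u ↦ u_μ` (scaling about the
blow-up point, which preserves `c`-DSS): any profile whose time `-1` slice is uniformly
`δ`-close is a rescaling of it. This is the rigidity a contraction-mapping construction would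
OUTPUT (Reiterer–Trubowitz 2019, p. 2); as an INPUT it buys nothing (census §Strengthen). -/
def IsolatedProfileExists : Prop :=
  ∃ G : Subgroup Iso3, IsPolyhedral G ∧ ∃ c : ℝ, 1 < c ∧ ∃ u, IsProfile G c u ∧
    ∃ δ : ℝ, 0 < δ ∧ ∀ u', IsProfile G c u' → (∀ x, ‖u' (-1) x - u (-1) x‖ < δ) →
      ∃ μ : ℝ, 0 < μ ∧ ∀ t < 0, ∀ x, u' t x = μ • u (μ ^ 2 * t) (μ • x)

/-- S⁺ → crux (forget the isolation clause). -/
theorem crux_of_isolated : IsolatedProfileExists → QuantisedSymmetry.PolyhedralDssProfileExists := by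
  rintro ⟨G, hG, c, hc, u, hu, -⟩
  exact crux_iff.2 ⟨G, hG, c, hc, u, hu⟩

/-! ## Decomposition Σ2: vanishing-residual family + Type-I compactness -/

/-- **Piece A (the ∃-content).** For one polyhedral sector `G` and factor `c` there are a Type-I
constant `C₀` and a nontriviality floor `δ > 0` such that for every `ε > 0` some classical,
`G`-equivariant, exactly `c`-DSS, Type-I(`C₀`) field solves Navier–Stokes on `(-∞,0) × ℝ³` up to a
force of scale-invariant size `ε` (`‖f(t,x)‖ ≤ ε (‖x‖ + √(-t))⁻³`) while keeping
`‖u(-1, x₀)‖ ≥ δ` at some `‖x₀‖ ≤ 1`. -/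
def ApproxFamily (G : Subgroup Iso3) (c : ℝ) : Prop :=
  ∃ C₀ δ : ℝ, 0 < δ ∧ ∀ ε > 0,
    ∃ (u f : ℝ → E3 → E3) (p : ℝ → E3 → ℝ),
      IsClassicalNSSolutionOn (Set.Iio 0) 1 f u p ∧ IsDiscretelySelfSimilar c u ∧
      HasTypeIDecay C₀ u ∧ (∀ g ∈ G, ∀ t x, u t (g x) = g (u t x)) ∧
      (∀ t < 0, ∀ x, ‖f t x‖ ≤ ε / (‖x‖ + Real.sqrt (-t)) ^ 3) ∧
      ∃ x₀ : E3, ‖x₀‖ ≤ 1 ∧ δ ≤ ‖u (-1) x₀‖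

/-- **Piece B (compactness bridge, provable in principle).** A vanishing-residual family with
uniform Type-I constant and floor has a subsequence converging locally smoothly to an exact
profile: uniform Type-I bound ⇒ uniform interior parabolic regularity for the forced system ⇒
Arzelà–Ascoli ⇒ the limit is an unforced classical, hence ancient mild, `c`-DSS, Type-I,
`G`-equivariant solution, nontrivial by the floor (the floor points accumulate in the closed
unit ball; equicontinuity transfers `δ`). Size M–L; standard tools. -/
def CompactnessBridge (G : Subgroup Iso3) (c : ℝ) : Prop :=
  ApproxFamily G c → ∃ u, IsProfile G c u

/-- **Assembly of Σ2 (proved):** pieces A and B for one admissible `(G, c)` give the crux. -/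
theorem crux_of_sigma2 {G : Subgroup Iso3} (hG : IsPolyhedral G) {c : ℝ} (hc : 1 < c)
    (hA : ApproxFamily G c) (hB : CompactnessBridge G c) :
    QuantisedSymmetry.PolyhedralDssProfileExists :=
  crux_iff.2 ⟨G, hG, c, hc, hB hA⟩

/-- Route-level form of Σ2: `(∃ admissible (G,c), ApproxFamily G c) → (∀ G c, CompactnessBridge G c) → crux`. -/
theorem crux_of_sigma2' :
    (∃ G : Subgroup Iso3, IsPolyhedral G ∧ ∃ c : ℝ, 1 < c ∧ ApproxFamily G c) →
      (∀ (G : Subgroup Iso3) (c : ℝ), IsPolyhedral G → 1 < c → CompactnessBridge G c) →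
        QuantisedSymmetry.PolyhedralDssProfileExists := by
  rintro ⟨G, hG, c, hc, hA⟩ hB
  exact crux_of_sigma2 hG hc hA (hB G c hG hc)

end Summit.NavierStokesRegularity.NavierStokesRegularity.Cruxes.PolyhedralDssProfileExists.StrategistS18g6
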